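import Summits.QuantumAdvantage.QuantumAdvantage.Theorems.WbwObfuscatedGluedTreesKowFPExtension
import Literature.Computability.Complexity.BPPErrorReduction
import Literature.Computability.Complexity.FPStringBricks
import Literature.Computability.Complexity.FoldBricks
import Literature.Computability.Complexity.CountingHierarchyProofs
import Literature.Computability.Complexity.TM2PassThrough

/-!
# `WbwObfuscatedGluedTrees` (stmt-QuantumAdvantage-2340) — line `knowledge-of-walk-split`: TOOLKIT II, coin-count normalisation of search adversaries

Helper file (generic, no crux-specific content) for the line `knowledge-of-walk-split` of crux
`WbwObfuscatedGluedTrees` (route `WhiteBoxWalk`), lead prover-line-stmt-QuantumAdvantage-2340-0.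

THE PROBLEM IT SOLVES. In the tree's model a PPT `A : RandAlg (List Bool) (List Bool)` has a coin budget
`A.coinLen : ℕ → ℕ` that is only polynomially BOUNDED — an arbitrary, possibly non-computable function of the
input length (the "coin budgets as advice" remark of `Indistinguishability.lean`).  A reduction that runs `A` on
inputs `x'` it manufactures itself cannot compute `A.coinLen |x'|`, hence cannot hand `A` a uniform coin string
of the right length.  For SEARCH-type success events (`A.pr x E`, any event `E`) this is repaired at
polynomial loss by GUESSING the coin count: `norm A p` reads a guess `j < 2^{width}` (`width = |bin (p |x|)|`)
off its first coins and runs `A` on the next `j` coins.  Results: `isPPT_norm` (the normalised algorithm is PPT,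
via TOOLKIT I `FPExtension.exists_FP_run` and the brick algebra), `norm_run_take` / `uniformProb_norm_of_le`
(PREFIX STABILITY: any uniform budget `N ≥ coinLen |x|` gives the same output law, so a host reduction may
simply pass "all remaining coins"), `pr_le_two_pow_mul` + `two_pow_width_le` (the loss
`A.pr x E ≤ (2 p(|x|) + 2) · (norm A p).pr x E`), packaged as `exists_norm`.  Not valid for distinguishing GAPS
(mixtures of wrong guesses do not cancel) — only for success probabilities, which is all the line needs.
-/

set_option linter.dupNamespace false

noncomputable section

namespace Summit.QuantumAdvantage.QuantumAdvantage.Theorems.WbwObfuscatedGluedTrees.KnowledgeOfWalk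

open Literature.Computability.Cryptography Literature.Computability.Complexity
open _root_.Computability Polynomial Brick Plumb

namespace CoinNormalisation

/-! ### Two counting facts -/

/-- **Product rule** for events on two independent coin blocks, probability form of `cnt_take_drop`.
[cite: AroraBarakCC2009, §7.4.1] -/
theorem uniformProb_take_drop (m d : ℕ) (E F : Set (List Bool)) :
    uniformProb (m + d) {y | y.take m ∈ E ∧ y.drop m ∈ F} = uniformProb m E * uniformProb d F := by
  rw [uniformProb_eq_cnt_div, uniformProb_eq_cnt_div, uniformProb_eq_cnt_div, cnt_take_drop, pow_add]
  push_cast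
  rw [div_mul_div_comm]

/-- Monotonicity of the counting probability. [folklore] -/
theorem uniformProb_mono {m : ℕ} {E E' : Set (List Bool)} (h : E ⊆ E') :
    uniformProb m E ≤ uniformProb m E' := by
  classical
  unfold uniformProb
  refine div_le_div_of_nonneg_right ?_ (by positivity)
  exact_mod_cast Finset.card_le_card fun r hr => by
    simp only [Finset.mem_filter, Finset.mem_univ, true_and] at hr ⊢
    exact h hr

/-- The probability of ONE string of the sampled length is `2^{-m}`. [folklore] -/
theorem uniformProb_singleton {g : List Bool} {m : ℕ} (hg : g.length = m) :
    uniformProb m {y | y = g} = 1 / 2 ^ m := by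
  classical
  have hiff : ∀ r : List.Vector Bool m, r.toList ∈ {y : List Bool | y = g} ↔ r = ⟨g, hg⟩ := fun r =>
    ⟨fun h => List.Vector.toList_injective (by simpa using h), fun h => by subst h; rfl⟩
  unfold uniformProb
  simp only [hiff, Finset.filter_eq', Finset.mem_univ, if_true, Finset.card_singleton, Nat.cast_one]

/-! ### Binary words of a prescribed width -/

/-- `word B v`: the `B` least significant bits of `v` (little-endian), a string of length exactly `B`.
[folklore] -/
def word : ℕ → ℕ → List Bool
  | 0, _ => []
  | B + 1, v => decide (v % 2 = 1) :: word B (v / 2)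

/-- `|word B v| = B`. [folklore] -/
@[simp] theorem length_word : ∀ B v : ℕ, (word B v).length = B
  | 0, _ => rfl
  | B + 1, v => by simp [word, length_word B]

/-- `bitsToNat (word B v) = v % 2^B`. [folklore] -/
theorem bitsToNat_word : ∀ B v : ℕ, bitsToNat (word B v) = v % 2 ^ B
  | 0, v => by simp [word, Nat.mod_one]
  | B + 1, v => by
    rw [word, bitsToNat_cons, bitsToNat_word B (v / 2), pow_succ', Nat.mod_mul]
    by_cases h : v % 2 = 1
    · simp [h]
    · have h0 : v % 2 = 0 := by omega
      simp [h0]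

/-- Below `2^B` the word is exact. [folklore] -/
theorem bitsToNat_word_of_lt {B v : ℕ} (hv : v < 2 ^ B) : bitsToNat (word B v) = v := by
  rw [bitsToNat_word, Nat.mod_eq_of_lt hv]

/-! ### The width of the guess and its cost -/

/-- The guess width at input length `L`: the binary length of `p(L)`. [folklore] -/
def width (p : Polynomial ℕ) (L : ℕ) : ℕ := (encodeNat (p.eval L)).length

/-- Every coin count `c ≤ p(L)` fits in `width p L` bits. [folklore] -/
theorem lt_two_pow_width (p : Polynomial ℕ) {L c : ℕ} (hc : c ≤ p.eval L) : c < 2 ^ width p L := by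
  have h := bitsToNat_lt (encodeNat (p.eval L))
  rw [bitsToNat_encodeNat] at h
  exact lt_of_le_of_lt hc h

/-- **The guessing loss is polynomial**: `2^{width} ≤ 2 p(L) + 2`. [folklore] -/
theorem two_pow_width_le (p : Polynomial ℕ) (L : ℕ) : (2 : ℝ) ^ width p L ≤ 2 * p.eval L + 2 := by
  have h1 : width p L ≤ Nat.log 2 (p.eval L) + 1 := TM2Pass.length_encodeNat_le _
  have h2 : (2 : ℕ) ^ width p L ≤ 2 * p.eval L + 2 := by
    refine (Nat.pow_le_pow_right two_pos h1).trans ?_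
    rw [pow_succ]
    rcases Nat.eq_zero_or_pos (p.eval L) with h0 | hpos
    · simp [h0]
    · have := Nat.pow_log_le_self 2 hpos.ne'
      omega
  exact_mod_cast h2

/-- `width p L ≤ p(L) + 1`. [folklore] -/
theorem width_le (p : Polynomial ℕ) (L : ℕ) : width p L ≤ p.eval L + 1 :=
  TM2Pass.length_encodeNat_le_self _

/-! ### The normalised algorithm -/

/-- **Coin-count normalisation of a search adversary.**  `norm A p` reads a GUESS `j` of `A`'s (possibly
non-computable) coin count off its first `width p |x|` coins (capped at `p |x|`) and runs `A` on the next `j`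
coins; its own coin budget `width p L + p L` is an explicit function of the input length.
[cite: AroraBarakCC2009, §7.1 (random tape model)] -/
def norm (A : RandAlg (List Bool) (List Bool)) (p : Polynomial ℕ) : RandAlg (List Bool) (List Bool) where
  run x ρ := A.run x ((ρ.drop (width p x.length)).take
    (min (bitsToNat (ρ.take (width p x.length))) (p.eval x.length)))
  coinLen L := width p L + p.eval L

/-- The coin budget of `norm A p` is at most `2 p(L) + 1`. [folklore] -/
theorem norm_coinLen_le (A : RandAlg (List Bool) (List Bool)) (p : Polynomial ℕ) (L : ℕ) :
    (norm A p).coinLen L ≤ (2 * p + 1 : Polynomial ℕ).eval L := by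
  have := width_le p L
  simp only [norm, eval_add, eval_mul, eval_ofNat, eval_one]
  omega

/-- **Prefix stability**: `norm A p` reads only the first `coinLen |x|` coins. [folklore] -/
theorem norm_run_take (A : RandAlg (List Bool) (List Bool)) (p : Polynomial ℕ) (x ρ : List Bool) {N : ℕ}
    (hN : (norm A p).coinLen x.length ≤ N) : (norm A p).run x (ρ.take N) = (norm A p).run x ρ := by
  simp only [norm] at hN ⊢
  have h1 : (ρ.take N).take (width p x.length) = ρ.take (width p x.length) := by
    rw [List.take_take, min_eq_left (by omega)]
  have h2 : ∀ j, j ≤ p.eval x.length →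
      ((ρ.take N).drop (width p x.length)).take j = (ρ.drop (width p x.length)).take j := by
    intro j hj
    rw [List.drop_take, List.take_take, min_eq_left (by omega)]
  rw [h1, h2 _ (min_le_right _ _)]

/-- **Prefix stability, probability form**: with any budget `N ≥ coinLen |x|` of uniform coins the output
law of `norm A p` is unchanged. [folklore] -/
theorem uniformProb_norm_of_le (A : RandAlg (List Bool) (List Bool)) (p : Polynomial ℕ) (x : List Bool)
    (E : Set (List Bool)) {N : ℕ} (hN : (norm A p).coinLen x.length ≤ N) :
    uniformProb N {ρ | (norm A p).run x ρ ∈ E} = (norm A p).pr id x E := by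
  rw [RandAlg.pr_eq_uniformProb, id, ← uniformProb_take_of_le hN {ρ | (norm A p).run x ρ ∈ E}]
  congr 1
  ext ρ
  simp only [Set.mem_setOf_eq]
  rw [norm_run_take A p x ρ le_rfl]

/-- **The normalised adversary is PPT** (its run map is an `FP` string program around `A`'s machine:
`polyFn`, `lenBinF`, `takeFn`, `dropFn`, `binToUnaryFn`; its budget is polynomial). [folklore] -/
theorem isPPT_norm {A : RandAlg (List Bool) (List Bool)} (hA : IsPPT A id) (p : Polynomial ℕ) :
    IsPPT (norm A p) id := by
  obtain ⟨R, hR, hRrun⟩ := FPExtension.exists_FP_run hA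
  -- the coin selector `⟨x, ρ⟩ ↦ (ρ ⇂ w) ↾ min ⟦ρ ↾ w⟧ (p |x|)`, `w = width p |x|`
  let wF : List Bool → List Bool := lenBinF ∘ polyFn p ∘ fstF
  let sel : List Bool → List Bool :=
    takeFn ∘ fanoutFn (binToUnaryFn ∘ fanoutFn (polyFn p ∘ fstF) (takeFn ∘ fanoutFn wF sndF))
      (dropFn ∘ fanoutFn wF sndF)
  have hwF : wF ∈ FP := comp_mem_FP lenBinF_mem_FP (comp_mem_FP (polyFn_mem_FP p) fstF_mem_FP)
  have hsel : sel ∈ FP :=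
    comp_mem_FP takeFn_mem_FP (fanoutFn_mem_FP
      (comp_mem_FP binToUnaryFn_mem_FP (fanoutFn_mem_FP (comp_mem_FP (polyFn_mem_FP p) fstF_mem_FP)
        (comp_mem_FP takeFn_mem_FP (fanoutFn_mem_FP hwF sndF_mem_FP))))
      (comp_mem_FP dropFn_mem_FP (fanoutFn_mem_FP hwF sndF_mem_FP)))
  have hsel_apply : ∀ x ρ : List Bool, sel (boolPair x ρ) =
      (ρ.drop (width p x.length)).take (min (bitsToNat (ρ.take (width p x.length))) (p.eval x.length)) := by
    intro x ρ
    have hw : wF (boolPair x ρ) = encodeNat (p.eval x.length) := by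
      simp [wF, ones]
    simp only [sel, Function.comp_apply, fanoutFn_apply, hw, fstF_boolPair, sndF_boolPair, takeFn_boolPair,
      dropFn_boolPair, polyFn_apply, binToUnaryFn_boolPair, width]
    simp [ones]
  refine FPExtension.isPolyTime_of_FP (F := R ∘ fanoutFn fstF sel)
    (comp_mem_FP hR (fanoutFn_mem_FP fstF_mem_FP hsel)) (fun x ρ => ?_) ⟨2 * p + 1, norm_coinLen_le A p⟩
  simp only [Function.comp_apply, fanoutFn_apply, fstF_boolPair, hsel_apply, hRrun, id]
  rfl

/-- **The guessing bound.**  If `A.coinLen |x| ≤ p |x|` then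
`A.pr x E ≤ 2^{width} · (norm A p).pr x E`: on the coin strings whose guess block is the word of the true
coin count the normalised algorithm runs `A` on a uniform string of exactly that length.
[cite: AroraBarakCC2009, §7.1] -/
theorem pr_le_two_pow_mul (A : RandAlg (List Bool) (List Bool)) (p : Polynomial ℕ) (x : List Bool)
    (E : Set (List Bool)) (hc : A.coinLen x.length ≤ p.eval x.length) :
    A.pr id x E ≤ (2 : ℝ) ^ width p x.length * (norm A p).pr id x E := by
  set w := width p x.length with hw
  set c := A.coinLen x.length with hcdef
  have hclt : c < 2 ^ w := lt_two_pow_width p hc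
  -- the good event: guess block = word of `c`, and `A` succeeds on the next `c` coins
  have hsub : {ρ : List Bool | ρ.take w ∈ {y : List Bool | y = word w c} ∧
      ρ.drop w ∈ {r : List Bool | r.take c ∈ {r' : List Bool | A.run x r' ∈ E}}} ⊆
      {ρ | (norm A p).run x ρ ∈ E} := by
    intro ρ hρ
    obtain ⟨h1, h2⟩ := hρ
    simp only [Set.mem_setOf_eq] at h1 h2 ⊢
    simp only [norm, ← hw, h1, bitsToNat_word_of_lt hclt, min_eq_left hc]
    exact h2
  have hprod := uniformProb_take_drop w (p.eval x.length) {y : List Bool | y = word w c}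
    {r : List Bool | r.take c ∈ {r' : List Bool | A.run x r' ∈ E}}
  rw [uniformProb_singleton (length_word w c), uniformProb_take_of_le hc] at hprod
  have hA : A.pr id x E = uniformProb c {r' : List Bool | A.run x r' ∈ E} := by
    rw [RandAlg.pr_eq_uniformProb]; rfl
  have hN : (norm A p).pr id x E = uniformProb (w + p.eval x.length) {ρ | (norm A p).run x ρ ∈ E} := by
    rw [RandAlg.pr_eq_uniformProb]; rfl
  have hmono := uniformProb_mono (m := w + p.eval x.length) hsub
  rw [hprod] at hmono
  rw [hA, hN]
  have hpos : (0 : ℝ) < 2 ^ w := by positivity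
  calc uniformProb c {r' | A.run x r' ∈ E}
      = 2 ^ w * (1 / 2 ^ w * uniformProb c {r' | A.run x r' ∈ E}) := by field_simp
    _ ≤ 2 ^ w * uniformProb (w + p.eval x.length) {ρ | (norm A p).run x ρ ∈ E} :=
        mul_le_mul_of_nonneg_left hmono hpos.le

/-- **Normalisation theorem (packaged).**  For every PPT `A : {0,1}* → {0,1}*` there are a PPT `A₁` and
polynomials `B` (budget bound) and `ℓ` (loss) such that `A₁` reads only its first `A₁.coinLen |x| ≤ B(|x|)`
coins (any larger uniform budget gives the same output law) and `A.pr x E ≤ ℓ(|x|) · A₁.pr x E` for every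
input `x` and event `E`. [cite: AroraBarakCC2009, §7.1] -/
theorem exists_norm {A : RandAlg (List Bool) (List Bool)} (hA : IsPPT A id) :
    ∃ A₁ : RandAlg (List Bool) (List Bool), IsPPT A₁ id ∧
      ∃ B ℓ : Polynomial ℕ, (∀ L, A₁.coinLen L ≤ B.eval L) ∧
        (∀ (x : List Bool) (E : Set (List Bool)) (N : ℕ), A₁.coinLen x.length ≤ N →
          uniformProb N {ρ | A₁.run x ρ ∈ E} = A₁.pr id x E) ∧
        (∀ (x : List Bool) (E : Set (List Bool)), A.pr id x E ≤ ℓ.eval x.length * A₁.pr id x E) := by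
  obtain ⟨p, hp⟩ := hA.2
  refine ⟨norm A p, isPPT_norm hA p, 2 * p + 1, 2 * p + 2, norm_coinLen_le A p,
    fun x E N hN => uniformProb_norm_of_le A p x E hN, fun x E => ?_⟩
  refine (pr_le_two_pow_mul A p x E (hp _)).trans ?_
  refine mul_le_mul_of_nonneg_right ?_ (RandAlg.pr_nonneg _ _ _ _)
  have := two_pow_width_le p x.length
  simpa using this

end CoinNormalisation

/-- Registered helper stub of crux stmt-QuantumAdvantage-2340 (closed form of `CoinNormalisation.exists_norm`): coin-count normalisation of search adversaries. [cite: AroraBarakCC2009, §7.1] -/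
theorem toolkit_coinNormalisation :
    ∀ (A : RandAlg (List Bool) (List Bool)), IsPPT A id → ∃ A₁ : RandAlg (List Bool) (List Bool), IsPPT A₁ id ∧ ∃ B ℓ : Polynomial ℕ, (∀ L, A₁.coinLen L ≤ B.eval L) ∧ (∀ (x : List Bool) (E : Set (List Bool)) (N : ℕ), A₁.coinLen x.length ≤ N → uniformProb N {ρ | A₁.run x ρ ∈ E} = A₁.pr id x E) ∧ (∀ (x : List Bool) (E : Set (List Bool)), A.pr id x E ≤ ℓ.eval x.length * A₁.pr id x E) :=
  fun _ hA => CoinNormalisation.exists_norm hA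

end Summit.QuantumAdvantage.QuantumAdvantage.Theorems.WbwObfuscatedGluedTrees.KnowledgeOfWalk

end
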